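import Summits.QuantumFields.BalabanUV.Beta.SymRootedJetReflection
import Summits.QuantumFields.BalabanUV.Beta.RootedJetTwist

/-!
# `BalabanUV.Beta.SymRootedJetTwist` — THE `τ₁τ₂`-TWIST LEMMA FOR THE (0.4)-SYMMETRISED ROOTED AVERAGED JET `symQjetLAt` ON THE GENERAL-BACKGROUND CHART
# (β sub-cell, row D1, TABLES-SYM-LEAN S2c, INTERFACE-LEVEL twin of an3-g33's `RootedJetTwist`; an1 gen 43)

HONEST FRAMING (cell charter, verbatim): «discharging BetaPertH makes Bałaban's UV stability UNCONDITIONAL — a real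
constructive-QFT result; it is NOT the continuum limit and NOT the Clay problem.»  HONEST DEPENDENCY (verbatim): «continuum YM on
T⁴ ⇐ BetaPertH ∧ nine spine estimates (0/9 proved); BetaPertH ⇐ (D1) ∧ (D4) ∧ CAP+tail; G-an2-4 gates asym, D1 and NE2/3/4.»
ABSOLUTE RULE (R-g25-7 ∕ R-D1-g30-1 (A)): the (0.4)-symmetrised averaging is the exp of the MEAN OF LOGS over the pair family
`{loop^{σ,σ′}}` with weight `((d!)²·L^d)⁻¹`; every object below is the comb module's algebra read on an1's `symPhiGAt` (S2b part 1)
instead of `PhiGAt` — STATEMENT FOR STATEMENT under the dictionary `PhiXAt ↦ symPhiXAt`, `XjetAt ↦ symXjetAt`, `MσXAt ↦ symMσXAt`,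
`L^{-d}·linAvgAt ↦ (d!·L^d)⁻¹·symLinU`, `L^{-d}·hessUAt ↦ ((d!)²L^d)⁻¹·symHessUAt`, `L^{-2d}·vhUAt ↦ ((d!)²L^{2d})⁻¹·symVhUAt`
(an3-g63 [AN3-G63-S2C] (C-ii): constants PER BCH ORDER; CONVENTION `(d!)²` un-normalised inside order-2 sym functionals).
FAMILY-INDEPENDENT chart ∕ letter ∕ `Tau`-algebra lemmas of the comb module are imported BY NAME, never re-proved.
DERIVED cell leaf: [folklore] ring algebra; the `sym*` families are [our object]s.  No statement of Bałaban's papers is typed here, no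
`[cite:]` tag, no `Prop` is minted, no binder of the β-function wall (`hW`/`hR`/`D1Tel`/`D1Rep`, (D1), `BetaPertH`) is instantiated or
discharged; nothing about the VALUES of `symMixFFAt`∕`symVh₂SAt` and no (T2-B)∕(T2-M₂) letter is discharged in this file.
NOT D1, NOT BetaPertH, NOT continuum, NOT Clay.  NOT summit progress.
Provenance: β sub-cell, TABLES-SYM-LEAN S2c option (C) (S2C-SCOPE-v1 94facb80ac685517), unit b2b-balaban-beta-an1-g43 (W-supplier AN1,
FREEZE (0): scratch for a courier; an1 files nothing), 2026-08-21; no existing file touched.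

## What this module proves (sym twin of `RootedJetTwist` §2–§4; the algebra maps `twistHom`∕`killHom`∕`lineHom`∕`flip1`, `twist_decomp`, the `ε`-lifted
## letters `liftT liftF twF twB` and their images, `mapDual_GfL`∕`mapDual_GbL`, `shadow_eq_Ebg`∕`_Ebi`, `flip1_Ebg_zero`∕`flip1_Ebi_zero` are the comb module's, BY NAME)
* §2 NATURALITY `map_symQjetLAt` (an1's `map_symPhiGAt`).
* §3 **THE TWIST LEMMA** `symQjetLAt_twist` and its components `c00∕c10∕c01∕c11_symQjetLAt_twist`, `c11_symQjetLAt_twist_of_aug`.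
* §4 ODDNESS `c10_symQjetAt_neg` and the symmetrised cancellation `c11_symQjetLAt_twist_symm`.
-/

namespace Summit.QuantumFields.BalabanUV.Beta.SymRootedJetTwist

open Literature.MathematicalPhysics.QuantumFieldTheory.Balaban1983to89
open Literature.MathematicalPhysics.QuantumFieldTheory.Balaban1983to89.Beta
open AffineAveraging (Form1)
open AveragingThirdJet (Tau Rho dmk fst_dmk snd_dmk dfst_mul dsnd_mul mapDual fst_mapDual snd_mapDual scaleDual fst_scaleDual
  snd_scaleDual Ebg Ebi logT invT map_logT map_invT)
open AveragingThirdJet.Tau (τ₁ τ₂ τ12 ι c00 c10 c01 c11 ext4 aug aug_apply)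
open Summit.QuantumFields.BalabanUV.Beta.RootedJetReflection (GfL GbL fst_GfL snd_GfL fst_GbL snd_GbL)
open Summit.QuantumFields.BalabanUV.Beta.RootedJetTwist (twistHom c00_twistHom c10_twistHom c01_twistHom c11_twistHom killHom c00_killHom c10_killHom
  c01_killHom c11_killHom lineHom c00_lineHom c10_lineHom c01_lineHom c11_lineHom twist_decomp flip1 c00_flip1 c10_flip1 c01_flip1 c11_flip1 flip1_ι
  mapDual_GfL mapDual_GbL liftT liftF twF twB twistHom_liftF twistHom_twF twistHom_twB killHom_liftF killHom_twF killHom_twB lineHom_aug_liftF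
  lineHom_aug_twF lineHom_aug_twB shadow_eq_Ebg shadow_eq_Ebi flip1_Ebg_zero flip1_Ebi_zero)
open Summit.QuantumFields.BalabanUV.Beta.SymAveragingMixedJetTables (symPhiGAt map_symPhiGAt symQjetAt)
open Summit.QuantumFields.BalabanUV.Beta.SymRootedJetReflection (symPhiLAt symQjetLAt symQjetAt_eq_symQjetLAt)

variable {𝕜 : Type*} [Field 𝕜] {d : ℕ} {𝔸 : Type*} [Ring 𝔸] [Algebra 𝕜 𝔸]

/-! ## §1 The algebra maps `twistHom`∕`killHom`∕`lineHom`∕`flip1`, `twist_decomp` and the `ε`-lifted letters: the comb module’s, opened BY NAME -/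

/-! ## §2 Naturality of `symQjetLAt` in the letter algebra; the `ε`-lifted letters -/

section Naturality

variable {R R' : Type*} [Ring R] [Algebra 𝕜 R] [Ring R'] [Algebra 𝕜 R'] (F : Tau R →ₐ[𝕜] Tau R')

set_option synthInstance.maxHeartbeats 200000 in
set_option maxHeartbeats 1600000 in
/-- [folklore] **NATURALITY OF THE ROOTED JET IN THE LETTER ALGEBRA**: `F (symQjetLAt ρ ω E Ē) = symQjetLAt ρ (F∘ω) (F∘E) (F∘Ē)`. -/
theorem map_symQjetLAt (ρ : Fin d → ℤ) (ω E Eb : Form1 d (Tau R)) (L : ℕ) (μ : Fin d) (y : Fin d → ℤ) :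
    F (symQjetLAt 𝕜 ρ ω E Eb L μ y)
      = symQjetLAt 𝕜 ρ (fun κ x => F (ω κ x)) (fun κ x => F (E κ x)) (fun κ x => F (Eb κ x)) L μ y := by
  unfold symQjetLAt symPhiLAt
  have key := congrArg TrivSqZeroExt.snd (map_logT (mapDual F)
    (symPhiGAt 𝕜 ρ (GfL ω E) (GbL ω Eb) L μ y * invT (symPhiGAt 𝕜 ρ (GfL 0 E) (GbL 0 Eb) L μ y)))
  simp only [map_mul, map_invT, map_symPhiGAt, mapDual_GfL, mapDual_GbL, snd_mapDual, Pi.zero_apply, map_zero] at key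
  exact key

end Naturality

variable (ω E Eb : Form1 d (Tau 𝔸)) (δ : Form1 d 𝔸) (κ : Fin d) (x : Fin d → ℤ)

/-! ## §3 The twist lemma -/

set_option synthInstance.maxHeartbeats 200000 in
set_option maxHeartbeats 1600000 in
/-- [folklore] **THE `τ₁τ₂`-TWIST LEMMA.**  Twisting the background pair by `(1 + τ₁τ₂ιδ, 1 − τ₁τ₂ιδ)` shifts the rooted jet by
`τ₁τ₂ · ι (c10 Q♭)`, `Q♭` the jet of the scalar-shadow configuration `(ι(c00 ω), ι(c00 E)(1+τ₁ιδ), (1−τ₁ιδ)ι(c00 Ē))`. -/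
theorem symQjetLAt_twist (ρ : Fin d → ℤ) (L : ℕ) (μ : Fin d) (y : Fin d → ℤ) :
    symQjetLAt 𝕜 ρ ω (fun κ x => E κ x * (1 + τ12 * ι (δ κ x))) (fun κ x => (1 - τ12 * ι (δ κ x)) * Eb κ x) L μ y
      = symQjetLAt 𝕜 ρ ω E Eb L μ y
        + τ12 * ι (c10 (symQjetLAt 𝕜 ρ (fun κ x => ι (c00 (ω κ x))) (fun κ x => ι (c00 (E κ x)) * (1 + τ₁ * ι (δ κ x)))
            (fun κ x => (1 - τ₁ * ι (δ κ x)) * ι (c00 (Eb κ x))) L μ y)) := by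
  have h1 := map_symQjetLAt (R := DualNumber 𝔸) (R' := 𝔸) (twistHom (𝕜 := 𝕜)) ρ (liftF ω) (twF E δ) (twB Eb δ) L μ y
  have h2 := map_symQjetLAt (R := DualNumber 𝔸) (R' := 𝔸) (killHom (𝕜 := 𝕜)) ρ (liftF ω) (twF E δ) (twB Eb δ) L μ y
  have h3 := map_symQjetLAt (R := DualNumber 𝔸) (R' := 𝔸) ((lineHom (𝕜 := 𝕜)).comp (aug (𝕜 := 𝕜))) ρ (liftF ω) (twF E δ)
    (twB Eb δ) L μ y
  simp only [twistHom_liftF, twistHom_twF, twistHom_twB] at h1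
  simp only [killHom_liftF, killHom_twF, killHom_twB] at h2
  simp only [AlgHom.comp_apply, lineHom_aug_liftF, lineHom_aug_twF, lineHom_aug_twB] at h3
  rw [← h1, twist_decomp, h2, h3]

/-- [folklore] **Components**: `c00`, `c10`, `c01` of the jet are UNCHANGED by the twist … -/
theorem c00_symQjetLAt_twist (ρ : Fin d → ℤ) (L : ℕ) (μ : Fin d) (y : Fin d → ℤ) :
    c00 (symQjetLAt 𝕜 ρ ω (fun κ x => E κ x * (1 + τ12 * ι (δ κ x))) (fun κ x => (1 - τ12 * ι (δ κ x)) * Eb κ x) L μ y)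
      = c00 (symQjetLAt 𝕜 ρ ω E Eb L μ y) := by
  rw [symQjetLAt_twist]; simp
/-- [folklore] -/
theorem c10_symQjetLAt_twist (ρ : Fin d → ℤ) (L : ℕ) (μ : Fin d) (y : Fin d → ℤ) :
    c10 (symQjetLAt 𝕜 ρ ω (fun κ x => E κ x * (1 + τ12 * ι (δ κ x))) (fun κ x => (1 - τ12 * ι (δ κ x)) * Eb κ x) L μ y)
      = c10 (symQjetLAt 𝕜 ρ ω E Eb L μ y) := by
  rw [symQjetLAt_twist]; simp
/-- [folklore] -/
theorem c01_symQjetLAt_twist (ρ : Fin d → ℤ) (L : ℕ) (μ : Fin d) (y : Fin d → ℤ) :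
    c01 (symQjetLAt 𝕜 ρ ω (fun κ x => E κ x * (1 + τ12 * ι (δ κ x))) (fun κ x => (1 - τ12 * ι (δ κ x)) * Eb κ x) L μ y)
      = c01 (symQjetLAt 𝕜 ρ ω E Eb L μ y) := by
  rw [symQjetLAt_twist]; simp

/-- [folklore] … and `c11` shifts by `c10` of the scalar-shadow jet. -/
theorem c11_symQjetLAt_twist (ρ : Fin d → ℤ) (L : ℕ) (μ : Fin d) (y : Fin d → ℤ) :
    c11 (symQjetLAt 𝕜 ρ ω (fun κ x => E κ x * (1 + τ12 * ι (δ κ x))) (fun κ x => (1 - τ12 * ι (δ κ x)) * Eb κ x) L μ y)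
      = c11 (symQjetLAt 𝕜 ρ ω E Eb L μ y)
        + c10 (symQjetLAt 𝕜 ρ (fun κ x => ι (c00 (ω κ x))) (fun κ x => ι (c00 (E κ x)) * (1 + τ₁ * ι (δ κ x)))
            (fun κ x => (1 - τ₁ * ι (δ κ x)) * ι (c00 (Eb κ x))) L μ y) := by
  rw [symQjetLAt_twist]; simp

/-- [folklore] **THE TWIST LEMMA FOR AUGMENTATION-ONE BACKGROUNDS**: the `c11`-shift is `c10 (symQjetAt ρ (ι∘c00∘ω) δ 0)`. -/
theorem c11_symQjetLAt_twist_of_aug (hE : ∀ κ x, c00 (E κ x) = 1) (hEb : ∀ κ x, c00 (Eb κ x) = 1) (ρ : Fin d → ℤ) (L : ℕ)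
    (μ : Fin d) (y : Fin d → ℤ) :
    c11 (symQjetLAt 𝕜 ρ ω (fun κ x => E κ x * (1 + τ12 * ι (δ κ x))) (fun κ x => (1 - τ12 * ι (δ κ x)) * Eb κ x) L μ y)
      = c11 (symQjetLAt 𝕜 ρ ω E Eb L μ y) + c10 (symQjetAt 𝕜 ρ (fun κ x => ι (c00 (ω κ x))) δ 0 L μ y) := by
  rw [c11_symQjetLAt_twist, shadow_eq_Ebg E δ hE, shadow_eq_Ebi Eb δ hEb, symQjetAt_eq_symQjetLAt]

/-! ## §4 Oddness in `δ` and the symmetrised cancellation -/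

set_option synthInstance.maxHeartbeats 200000 in
set_option maxHeartbeats 1600000 in
/-- [folklore] **ODDNESS**: for a SCALAR fluctuation letter `ι∘a`, `c10 (symQjetAt ρ (ι∘a) (−δ) 0) = − c10 (symQjetAt ρ (ι∘a) δ 0)`. -/
theorem c10_symQjetAt_neg (a : Form1 d 𝔸) (ρ : Fin d → ℤ) (L : ℕ) (μ : Fin d) (y : Fin d → ℤ) :
    c10 (symQjetAt 𝕜 ρ (fun κ x => ι (a κ x)) (-δ) 0 L μ y) = -c10 (symQjetAt 𝕜 ρ (fun κ x => ι (a κ x)) δ 0 L μ y) := by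
  have h := map_symQjetLAt (R := 𝔸) (R' := 𝔸) (flip1 (𝕜 := 𝕜)) ρ (fun κ x => ι (a κ x)) (Ebg δ 0) (Ebi δ 0) L μ y
  simp only [flip1_ι, flip1_Ebg_zero, flip1_Ebi_zero] at h
  rw [symQjetAt_eq_symQjetLAt, symQjetAt_eq_symQjetLAt, ← h, c10_flip1]

/-- [folklore] **THE TWIST CANCELS UNDER `δ ↦ −δ` SYMMETRISATION**: for two augmentation-one background pairs twisted by OPPOSITE
`δ`, the sum of the `c11`-components of the jets equals the untwisted sum. -/
theorem c11_symQjetLAt_twist_symm (E' Eb' : Form1 d (Tau 𝔸)) (hE : ∀ κ x, c00 (E κ x) = 1) (hEb : ∀ κ x, c00 (Eb κ x) = 1)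
    (hE' : ∀ κ x, c00 (E' κ x) = 1) (hEb' : ∀ κ x, c00 (Eb' κ x) = 1) (ρ : Fin d → ℤ) (L : ℕ) (μ : Fin d) (y : Fin d → ℤ) :
    c11 (symQjetLAt 𝕜 ρ ω (fun κ x => E κ x * (1 + τ12 * ι (δ κ x))) (fun κ x => (1 - τ12 * ι (δ κ x)) * Eb κ x) L μ y)
      + c11 (symQjetLAt 𝕜 ρ ω (fun κ x => E' κ x * (1 + τ12 * ι ((-δ) κ x))) (fun κ x => (1 - τ12 * ι ((-δ) κ x)) * Eb' κ x)
          L μ y)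
      = c11 (symQjetLAt 𝕜 ρ ω E Eb L μ y) + c11 (symQjetLAt 𝕜 ρ ω E' Eb' L μ y) := by
  rw [c11_symQjetLAt_twist_of_aug ω E Eb δ hE hEb, c11_symQjetLAt_twist_of_aug ω E' Eb' (-δ) hE' hEb', c10_symQjetAt_neg]
  abel

end Summit.QuantumFields.BalabanUV.Beta.SymRootedJetTwist
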